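/-
Copyright (c) 2026. All rights reserved.
Released under Apache 2.0 license as described in the file LICENSE.
Authors: abc-iut cell, wave-5 seat abc-iut-w5-d141 (L3 sub-DAG [SemiAnbd] Thm 5.4, umbrella junction v5: the binder `hact`
at the outer-semidirect-product model).
-/
import Literature.AnabelianGeometry.SemiGraphs.ArithTemperedGroupOfOuterAction
import Literature.AnabelianGeometry.SemiGraphs.ArithOuterActionOfGraphAction
import HarnessLib

/-!
# [SemiAnbd] Thm 5.4 (iii) junction v5: the binder `hact` («conjugation by `γ ∈ Π^temp_𝔊` on `ι(π₁^temp 𝔾)` represents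
# `(F (aug γ))^*`») DISCHARGED at the outer-semidirect-product model of `Π^temp_𝔊` (proof-only)

Mochizuki, *Semi-graphs of anabelioids*, Publ. RIMS **42** (2006), §0 p. 5 (outer semi-direct products), §5 Def 5.1 (i)
p. 62, Prop 5.2 (iv) p. 64, Thm 5.4 (iii) p. 66; §3 Prop 3.2 p. 35, Prop 3.6 (iv) p. 39
[cite: MochizukiSemiAnbd2006, Prop 5.2 (iv), p. 64].

PROOF-ONLY (no definition; cell abc-iut, layer L3, T54 junction, seat abc-iut-w5-d141).  The junction v5
(`ArithThm54iiiUmbrellaOfChartDict.lean`) binds, for the graph actions `F_𝔾 : Π_A → Hom 𝔾 𝔾` with chosen 2-cells, the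
hypothesis `hact𝒢` / `hactℋ`: for every `γ ∈ Π^temp_𝔊` a continuous `c_γ : π₁^temp(𝔾) → π₁^temp(𝔾)` with
`ι(c_γ y) = γ · ι(y) · γ⁻¹` and `(F_𝔾 (aug γ))^* ≅ B^temp(c_γ)` — abc-iut-w4-d053's ruling: «the outer model's
`Aut`-component IS a representative».  Here this is a THEOREM for the algebraic model of the cell
(`ArithTemperedGroupOfOuterAction.lean`: `Π^temp_𝔊 := π₁^temp(𝔾) ⋊^out Π_A` along an outer action `ρ`, `ι :=
toOuterSemidirectProduct ρ`, `aug := outerSemidirectProductSnd ρ`): whenever every class `ρ a` has a representative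
`Φ_a` with `(F a)^*_{θ a} ≅ B^temp(Φ_a)` (`hact_outerSemidirectProduct`; `c_γ :=` the `Aut`-component of `γ`, conjugation
formula `conj_toOuterSemidirectProduct`, two representatives differ by an inner automorphism `exists_conj_of_mk_eq`,
`BTemp.resIsoOfConj`), in particular for the outer action PRODUCED from a pseudo-functorial graph action by
abc-iut-w4-d082's `exists_outerAction_of_graphAction` at the chosen conjugators (`exists_outerAction_hact_of_graphAction`).
Nothing asserted for real tempered data (the tempered TOPOLOGY on `Π^temp_𝔊` is producer debt T54-B); nothing here bears on
[IUTchIII] Cor. 3.12; typed ≠ proved.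
-/

namespace Literature.AnabelianGeometry.SemiGraphs

namespace ProfiniteSemiGraph

open _root_.CategoryTheory Literature.AnabelianGeometry.EtaleTheta

universe u w

variable {𝒢 : ProfiniteSemiGraph.{u}} (c : TemperedPiChart 𝒢) {PA : Type w} [Group PA]

/-- **`hact` at the outer-semidirect-product model**: for `Π^temp_𝔊 := π₁^temp(𝔾) ⋊^out Π_A` along
`ρ : Π_A → Out(π₁^temp 𝔾)` and a graph action `F : Π_A → Hom 𝔾 𝔾` with chosen 2-cells `θ` such that every class `ρ a`
is represented by a bi-continuous `Φ_a` with `(F a)^*_{θ a} ≅ B^temp(Φ_a)`, conjugation by ANY `γ ∈ Π^temp_𝔊` on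
`ι(π₁^temp 𝔾)` is `ι ∘ c_γ` for the `Aut`-component `c_γ` of `γ` (§0 p. 5), and `(F (aug γ))^*_{θ} ≅ B^temp(c_γ)`
(`c_γ` and `Φ_{aug γ}` represent the same outer class, hence are conjugate; Prop 3.2, easy half).
[cite: MochizukiSemiAnbd2006, Prop 5.2 (iv), p. 64] -/
theorem hact_outerSemidirectProduct (ρ : PA →* TopOut c.G) (F : PA → Hom 𝒢 𝒢)
    (θ : ∀ a, (F a).ConjugatorFamily)
    (hrep : ∀ a, ∃ (Φ : contMulAut c.G) (φ : c.G →ₜ* c.G), TopOut.mk c.G Φ = ρ a ∧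
      (∀ t, (Φ : MulAut c.G) t = φ t) ∧ Nonempty ((F a).chartPullbackWith (θ a) c c ≅ BTemp.res φ))
    (γ : outerSemidirectProduct ρ) :
    ∃ cγ : c.G →ₜ* c.G, (∀ y, toOuterSemidirectProduct ρ (cγ y) =
        γ * toOuterSemidirectProduct ρ y * γ⁻¹) ∧
      Nonempty ((F (outerSemidirectProductSnd ρ γ)).chartPullbackWith (θ (outerSemidirectProductSnd ρ γ)) c c ≅
        BTemp.res cγ) := by
  obtain ⟨Φ, φ, hΦρ, hΦφ, ⟨eF⟩⟩ := hrep (outerSemidirectProductSnd ρ γ)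
  -- the `Aut`-component of `γ` and `Φ` represent the same outer class, hence are conjugate
  have hcls : TopOut.mk c.G Φ = TopOut.mk c.G γ.1.1 := by
    rw [hΦρ, mk_fst_eq_rho_snd]
  obtain ⟨g, hg⟩ := exists_conj_of_mk_eq Φ γ.1.1 hcls
  -- the `Aut`-component of `γ` as a continuous homomorphism
  let cγ : c.G →ₜ* c.G :=
    { (γ.1.1 : MulAut c.G).toMonoidHom with continuous_toFun := γ.1.1.2.1 }
  have hcγ : ∀ y, cγ y = (γ.1.1 : MulAut c.G) y := fun _ => rfl
  refine ⟨cγ, fun y => ?_, ⟨eF ≪≫ BTemp.resIsoOfConj φ cγ g fun x => ?_⟩⟩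
  · rw [hcγ]
    exact (conj_toOuterSemidirectProduct ρ γ y).symm
  · rw [hcγ, ← hΦφ]
    exact (hg x).symm

/-- **`hact` for the outer action PRODUCED from a graph action** (abc-iut-w4-d082's
`exists_outerAction_of_graphAction`, Prop 3.6 (iv) + Prop 3.2, at the chosen conjugators): a pseudo-functorial action
`F : Π_A → Hom 𝔾 𝔾` yields `ρ : Π_A → Out(π₁^temp 𝔾)` such that on `Π^temp_𝔊 := π₁^temp(𝔾) ⋊^out_ρ Π_A` the junction-v5
binder `hact𝒢` holds with `θ𝒢 := chosenConjugators`. [cite: MochizukiSemiAnbd2006, Prop 5.2 (iv), p. 64] -/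
theorem exists_outerAction_hact_of_graphAction (F : PA → Hom 𝒢 𝒢)
    (hmul : ∀ a b, Nonempty ((F (a * b)).chartPullback c c ≅ (F a).chartPullback c c ⋙ (F b).chartPullback c c))
    (hone : Nonempty ((F 1).chartPullback c c ≅ 𝟭 (BTemp c.G))) :
    ∃ ρ : PA →* TopOut c.G, ∀ γ : outerSemidirectProduct ρ, ∃ cγ : c.G →ₜ* c.G,
      (∀ y, toOuterSemidirectProduct ρ (cγ y) = γ * toOuterSemidirectProduct ρ y * γ⁻¹) ∧
      Nonempty ((F (outerSemidirectProductSnd ρ γ)).chartPullbackWith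
        (F (outerSemidirectProductSnd ρ γ)).chosenConjugators c c ≅ BTemp.res cγ) := by
  obtain ⟨ρ, hρ⟩ := exists_outerAction_of_graphAction c F hmul hone
  exact ⟨ρ, hact_outerSemidirectProduct c ρ F (fun a => (F a).chosenConjugators) hρ⟩

end ProfiniteSemiGraph

end Literature.AnabelianGeometry.SemiGraphs
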